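import Literature.NumberTheory.Automorphic.BorelGoodPlaceHecke
import Literature.NumberTheory.Automorphic.BorelHeckeLocalGL2Degree
import Literature.NumberTheory.Automorphic.HeckeContractingElement
import Literature.NumberTheory.Automorphic.TwistedCentralHecke
import Literature.RingTheory.DiscreteValuationRing.AdicCompletionResidueField
import HarnessLib

/-!
# The push–pull relation on the Borel model: `T^B_{t₂⁻¹} T^B_{t₂} = N(w)`, `T^B_{t₁} = T^B_{t₂⁻¹} T_{w,2}`

Topic `NumberTheory/Automorphic`; namespace `Literature.NumberTheory.Automorphic`, grouping
sub-namespaces `TwistedQuotient` (a generic lemma) and `BigHeckeGLn`.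

Continuing `BorelGoodPlaceHecke` (`H_S`, `t^B_1 = ι_w(diag(ϖ,1))`, `t^B_2 = ι_w(diag(1,ϖ))`,
`U` unramified at `w ∉ S`), on the twisted cohomology `H^q(Γ, Fun(H_S ⧸ (U ∩ H_S), V))` of the
Borel model:

* `borelHeckeElement₂_conj_mem` — `t^B_2` CONTRACTS the level: `(t^B_2)⁻¹ (U ∩ H_S) t^B_2 ⊆ U ∩ H_S`
  (locally `t₂⁻¹ (B ∩ K) t₂ ⊆ B ∩ K`, `conj_heckeLocalDiag'_mem`);
* `card_doubleCosetQuot_borelHeckeElement₂_inv` — the degree of `(t^B_2)⁻¹` is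
  **`N(w) = #(𝓞_K / w)`** (the `q` cosets `n(b_i) t₂⁻¹`, `BorelHeckeLocalGL2Degree`, counted by
  the residue field of `K_w`, `natCard_residueField_adicCompletion`);
* `heckeEnd_borelHeckeElement₂_inv_heckeEnd` — **push–pull `T^B_{t₂⁻¹} (T^B_{t₂} y) = N(w) • y`**
  (`HeckeContractingElement.heckeEnd_inv_apply_heckeEnd_of_conj`);
* `heckeEnd_borelHeckeElement₁_eq` — **`T^B_{t₁} = T^B_{t₂⁻¹} ∘ T_{z_w}`** with
  `z_w = t_{w,2} = ι_w(ϖ · 1)` central (`t₁ = z_w t₂⁻¹`; `TwistedQuotient.heckeEnd_central_mul_apply`);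
* `subgroupRestrictMap_heckeEnd_heckeElement_two` — `res (T_{w,2} x) = T_{z_w} (res x)`.

Together with `subgroupRestrictMap_heckeEnd_heckeElement_one` this puts the restriction of a
`T_{w,1}, T_{w,2}`-eigenclass to the Borel model exactly in the shape of
`PushPullHeckeEigenvalues.exists_pushPull_eigenvalues` (`X = T^B_{t₂}`, `Y = T^B_{t₂⁻¹}`,
`Z = T_{z_w}`, `q = N(w)`), [Harder1987, §2].

## References

* G. Harder, *Eisenstein cohomology of arithmetic groups. The case GL₂*, Invent. Math. 89 (1987), §2
  [Harder1987].
-/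

noncomputable section

open scoped NumberField
open IsDedekindDomain CategoryTheory

namespace Literature.NumberTheory.Automorphic

/-! ### `T_{z g} = T_g ∘ T_z` for `z` central (twisted cohomology) -/

namespace TwistedQuotient

section Central

universe u

variable {k : Type u} [CommRing k] {Γ 𝒢 : Type u} [Group Γ] [Group 𝒢]
variable (ι : Γ →* 𝒢) (L : Subgroup 𝒢) {V : Type u} [AddCommGroup V] [Module k V]
  (ρ : Representation k Γ V)

/-- `T_{z g} = T_z ≫ T_g` on the coefficient representation, `z` central, `L g L / L` finite.
[cite: ShimuraIATAF1971, Ch. 3, §3.1] -/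
theorem heckeRepHom_central_mul {z : 𝒢} (hz : z ∈ Subgroup.center 𝒢) {g : 𝒢}
    (hfin : (ArithmeticQuotient.doubleCosetQuot L g).Finite) :
    heckeRepHom ι L ρ (z * g) = heckeRepHom ι L ρ z ≫ heckeRepHom ι L ρ g := by
  refine Rep.hom_ext (Representation.IntertwiningMap.ext (LinearMap.ext fun f => ?_))
  change ArithmeticQuotient.heckeFun k L (z * g) V f =
    ArithmeticQuotient.heckeFun k L g V (ArithmeticQuotient.heckeFun k L z V f)
  rw [ArithmeticQuotient.heckeFun_central_mul k L V hz hfin f]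
  congr 1
  funext c
  rw [ArithmeticQuotient.heckeFun_apply_of_mem_center k L V hz f c]

/-- **`T_{z g} y = T_g (T_z y)`** on twisted cohomology, `z` central. [cite: ShimuraIATAF1971, Ch. 3, §3.1] -/
theorem heckeEnd_central_mul_apply {z : 𝒢} (hz : z ∈ Subgroup.center 𝒢) {g : 𝒢}
    (hfin : (ArithmeticQuotient.doubleCosetQuot L g).Finite) (q : ℕ) (x : cohomology ι L ρ q) :
    heckeEnd ι L ρ (z * g) q x = heckeEnd ι L ρ g q (heckeEnd ι L ρ z q x) := by
  change (groupCohomology.map (MonoidHom.id Γ) (heckeRepHom ι L ρ (z * g)) q).hom x =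
    (heckeOperator ι L ρ z q ≫ heckeOperator ι L ρ g q).hom x
  rw [heckeRepHom_central_mul ι L ρ hz hfin, heckeOperator, heckeOperator,
    ← groupCohomology.map_id_comp]

/-- `T_g (T_z y) = T_z (T_g y)`: central Hecke operators commute with all Hecke operators.
[folklore] -/
theorem heckeEnd_comm_central {z : 𝒢} (hz : z ∈ Subgroup.center 𝒢) {g : 𝒢}
    (hfin : (ArithmeticQuotient.doubleCosetQuot L g).Finite) (q : ℕ) (x : cohomology ι L ρ q) :
    heckeEnd ι L ρ g q (heckeEnd ι L ρ z q x) = heckeEnd ι L ρ z q (heckeEnd ι L ρ g q x) := by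
  rw [← heckeEnd_central_mul_apply ι L ρ hz hfin]
  -- `z g = g z`, and `T_{g z} = T_z ∘ T_g` on functions by `heckeFun_comp_smul`
  have hzg : z * g = g * z := (Subgroup.mem_center_iff.1 hz g).symm
  have hrep : heckeRepHom ι L ρ (z * g) = heckeRepHom ι L ρ g ≫ heckeRepHom ι L ρ z := by
    refine Rep.hom_ext (Representation.IntertwiningMap.ext (LinearMap.ext fun f => ?_))
    change ArithmeticQuotient.heckeFun k L (z * g) V f =
      ArithmeticQuotient.heckeFun k L z V (ArithmeticQuotient.heckeFun k L g V f)
    rw [ArithmeticQuotient.heckeFun_central_mul k L V hz hfin f,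
      ArithmeticQuotient.heckeFun_comp_smul k L V z g f]
    funext c
    rw [ArithmeticQuotient.heckeFun_apply_of_mem_center k L V hz]
  change (groupCohomology.map (MonoidHom.id Γ) (heckeRepHom ι L ρ (z * g)) q).hom x =
    (heckeOperator ι L ρ g q ≫ heckeOperator ι L ρ z q).hom x
  rw [hrep, heckeOperator, heckeOperator, ← groupCohomology.map_id_comp]

end Central

end TwistedQuotient

/-! ### The residue field of `K_w` has `N(w)` elements -/

section Residues

variable (K : Type) [Field K] [NumberField K] (w : HeightOneSpectrum (𝓞 K))

/-- A finite residue system of `K_w` indexed by a type with `N(w) = #(𝓞 K ⧸ w)` elements.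
[folklore] -/
theorem exists_residueSystem_card :
    ∃ (ι : Type) (_ : Fintype ι) (b : ι → w.adicCompletion K),
      (∀ i, Valued.v (b i) ≤ 1) ∧
      (∀ x : w.adicCompletion K, Valued.v x ≤ 1 → ∃ i, Valued.v (x - b i) < 1) ∧
      (∀ i j, Valued.v (b i - b j) < 1 → i = j) ∧ Nat.card ι = Ideal.absNorm w.asIdeal := by
  classical
  haveI : Finite (Valued.ResidueField (w.adicCompletion K)) := finite_residueField_adicCompletion K w
  letI : Fintype (Valued.ResidueField (w.adicCompletion K)) := Fintype.ofFinite _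
  have hres : Function.Surjective (IsLocalRing.residue (Valued.integer (w.adicCompletion K))) :=
    IsLocalRing.residue_surjective
  set s : Valued.ResidueField (w.adicCompletion K) → Valued.integer (w.adicCompletion K) :=
    Function.surjInv hres with hs
  have hss : ∀ r, IsLocalRing.residue _ (s r) = r := fun r => Function.surjInv_eq hres r
  have hmax : ∀ z : Valued.integer (w.adicCompletion K),
      z ∈ IsLocalRing.maximalIdeal _ ↔ Valued.v (z : w.adicCompletion K) < 1 := fun z => by
    rw [IsLocalRing.mem_maximalIdeal, mem_nonunits_iff]
    exact Valuation.Integer.not_isUnit_iff_valuation_lt_one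
  have hres_eq : ∀ a c : Valued.integer (w.adicCompletion K),
      IsLocalRing.residue _ a = IsLocalRing.residue _ c ↔ a - c ∈ IsLocalRing.maximalIdeal _ :=
    fun a c => Ideal.Quotient.eq
  refine ⟨Valued.ResidueField (w.adicCompletion K), inferInstance,
    fun r => ((s r : Valued.integer (w.adicCompletion K)) : w.adicCompletion K),
    fun r => (Valuation.mem_integer_iff _ _).1 (s r).2, fun x hx => ?_, fun i j hij => ?_, ?_⟩
  · let z : Valued.integer (w.adicCompletion K) := ⟨x, (Valuation.mem_integer_iff _ _).2 hx⟩
    refine ⟨IsLocalRing.residue _ z, ?_⟩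
    have h : s (IsLocalRing.residue _ z) - z ∈ IsLocalRing.maximalIdeal _ :=
      (hres_eq _ _).1 (hss _)
    have h' := (hmax _).1 h
    rw [AddSubgroupClass.coe_sub, Valuation.map_sub_swap] at h'
    exact h'
  · have h : s i - s j ∈ IsLocalRing.maximalIdeal _ :=
      (hmax _).2 (by rwa [AddSubgroupClass.coe_sub])
    rw [← hres_eq, hss, hss] at h
    exact h
  · rw [Ideal.absNorm_apply, Submodule.cardQuot_apply]
    exact HeightOneSpectrum.natCard_residueField_adicCompletion K w

end Residues

namespace BigHeckeGLn

variable {K : Type} [Field K] [NumberField K]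
variable {S : Set (HeightOneSpectrum (𝓞 K))} {w : HeightOneSpectrum (𝓞 K)} (hw : w ∉ S)
  {U : Subgroup (FiniteAdelicGL 2 K)}
  (hU : ArithmeticQuotient.IsUnramifiedLevel
    (valuedCongruenceSubgroup (Fin 2) (1 : WithZero (Multiplicative ℤ)))
    (ofLocal 2 K w) (localComponent 2 K w) U)

/-! ### `t^B_2` contracts the level; its inverse has degree `N(w)` -/

section Contract

include hw hU

/-- **`(t^B_2)⁻¹ (U ∩ H_S) t^B_2 ⊆ U ∩ H_S`**: an element `m ∈ U ∩ H_S` is `m₀ ι_w(l)` with `m₀ ∈ U`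
trivial at `w` and `l = m_w ∈ B(K_w) ∩ GL₂(𝒪_w)`, and `t₂⁻¹ l t₂ ∈ B ∩ GL₂(𝒪_w)`
(`conj_heckeLocalDiag'_mem`). [cite: Harder1987, §2] -/
theorem borelHeckeElement₂_conj_mem :
    ∀ m ∈ U.subgroupOf (borelAwayFrom (n := 2) S),
      (borelHeckeElement₂ S w)⁻¹ * m * borelHeckeElement₂ S w ∈ U.subgroupOf (borelAwayFrom S) := by
  intro m hm
  have hmU : (m : FiniteAdelicGL 2 K) ∈ U := Subgroup.mem_subgroupOf.1 hm
  have hϖ1 : Valued.v ((uniformizerAt w : (w.adicCompletion K)ˣ) : w.adicCompletion K) ≤ 1 := by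
    rw [valued_coe_uniformizerAt, ← WithZero.exp_zero, WithZero.exp_le_exp]; omega
  rw [Subgroup.mem_subgroupOf, Subgroup.coe_mul, Subgroup.coe_mul, Subgroup.coe_inv,
    coe_borelHeckeElement₂]
  set l := localComponent 2 K w (m : FiniteAdelicGL 2 K) with hl
  have hlB : l ∈ borelGL2 (w.adicCompletion K) := (mem_borelAwayFrom_iff.1 m.2) w hw
  have hlK : l ∈ GL2Int (w.adicCompletion K) := hU.apply_mem hmU
  -- `m = m₀ ι(l)` with `m₀` trivial at `w`
  have hm₀ : (m : FiniteAdelicGL 2 K) * (ofLocal 2 K w l)⁻¹ ∈ U := hU.mul_inv_mem hmU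
  have hm₀w : localComponent 2 K w ((m : FiniteAdelicGL 2 K) * (ofLocal 2 K w l)⁻¹) = 1 :=
    hU.apply_mul_inv
  have hdecomp : (m : FiniteAdelicGL 2 K) =
      (m : FiniteAdelicGL 2 K) * (ofLocal 2 K w l)⁻¹ * ofLocal 2 K w l := by
    rw [inv_mul_cancel_right]
  have hconj := conj_heckeLocalDiag'_mem _ (uniformizerAt w).ne_zero hϖ1 hlB hlK
  have hcomm : (ofLocal 2 K w (localT₂ w))⁻¹ * ((m : FiniteAdelicGL 2 K) * (ofLocal 2 K w l)⁻¹) =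
      (m : FiniteAdelicGL 2 K) * (ofLocal 2 K w l)⁻¹ * (ofLocal 2 K w (localT₂ w))⁻¹ := by
    rw [← map_inv]
    exact (mul_ofLocal_comm hm₀w _).symm
  rw [hdecomp, ← mul_assoc, hcomm, mul_assoc, mul_assoc]
  refine mul_mem hm₀ ?_
  rw [← map_mul, ← map_inv, ← map_mul]
  refine hU.map_mem ?_
  rw [← mul_assoc]
  exact (Subgroup.mem_inf.1 hconj).2

/-- The image in `𝒢 ⧸ U` of the `H_S`-double coset of `(t^B_2)⁻¹`:
`{ι_w(l t₂⁻¹) U : l ∈ B ∩ K}`. [folklore] -/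
theorem image_toQuot_doubleCosetQuot_borelHeckeElement₂_inv :
    TwistedQuotient.toQuot U (borelAwayFrom S) ''
        ArithmeticQuotient.doubleCosetQuot (U.subgroupOf (borelAwayFrom S))
          ((borelHeckeElement₂ S w)⁻¹ : borelAwayFrom (n := 2) S) =
      {c | ∃ l ∈ borelGL2 (w.adicCompletion K) ⊓ GL2Int (w.adicCompletion K),
        c = (((ofLocal 2 K w ((l : GL (Fin 2) (w.adicCompletion K)) * (localT₂ w)⁻¹)) :
          FiniteAdelicGL 2 K) : FiniteAdelicGL 2 K ⧸ U)} := by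
  rw [borelHeckeElement₂, ← map_inv]
  exact image_toQuot_doubleCosetQuot_ofBorelLocal hw hU _

/-- It is `localCoset` of the `N(w)` distinct cosets `n(b_i) t₂⁻¹ GL₂(𝒪_w)`. [folklore] -/
theorem image_toQuot_doubleCosetQuot_borelHeckeElement₂_inv_eq_range {ι : Type} (b : ι → w.adicCompletion K)
    (hbint : ∀ i, Valued.v (b i) ≤ 1)
    (hb : ∀ x : w.adicCompletion K, Valued.v x ≤ 1 → ∃ i, Valued.v (x - b i) < 1) :
    TwistedQuotient.toQuot U (borelAwayFrom S) ''
        ArithmeticQuotient.doubleCosetQuot (U.subgroupOf (borelAwayFrom S))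
          ((borelHeckeElement₂ S w)⁻¹ : borelAwayFrom (n := 2) S) =
      Set.range fun i : ι => hU.localCoset
        ((((Matrix.GeneralLinearGroup.upperRightHom (b i) : GL (Fin 2) (w.adicCompletion K)) *
            (localT₂ w)⁻¹ : GL (Fin 2) (w.adicCompletion K))) :
          GL (Fin 2) (w.adicCompletion K) ⧸ GL2Int (w.adicCompletion K)) := by
  have hϖ := valued_coe_uniformizerAt (K := K) w
  rw [image_toQuot_doubleCosetQuot_borelHeckeElement₂_inv hw hU]
  ext c
  simp only [Set.mem_setOf_eq, Set.mem_range]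
  constructor
  · rintro ⟨l, hl, rfl⟩
    obtain ⟨i, hi⟩ := exists_upperRight_mul_heckeLocalDiag'_inv_coset_eq _ b (uniformizerAt w).ne_zero
      hϖ hb (Subgroup.mem_inf.1 hl).1 (Subgroup.mem_inf.1 hl).2
    exact ⟨i, by rw [← hi, hU.localCoset_mk]⟩
  · rintro ⟨i, rfl⟩
    exact ⟨_, ⟨upperRightHom_mem_borelGL2 _, upperRightHom_mem_GL2Int (hbint i)⟩,
      by rw [hU.localCoset_mk]⟩

/-- The `H_S`-double coset of `(t^B_2)⁻¹` is finite … [folklore] -/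
theorem finite_doubleCosetQuot_borelHeckeElement₂_inv :
    (ArithmeticQuotient.doubleCosetQuot (U.subgroupOf (borelAwayFrom S))
      ((borelHeckeElement₂ S w)⁻¹ : borelAwayFrom (n := 2) S)).Finite := by
  obtain ⟨ι, _, b, hbint, hb, -, -⟩ := exists_residueSystem_card K w
  refine Set.Finite.of_finite_image ?_ (TwistedQuotient.toQuot_injective U (borelAwayFrom S)).injOn
  rw [image_toQuot_doubleCosetQuot_borelHeckeElement₂_inv_eq_range hw hU b hbint hb]
  exact Set.finite_range _

/-- **… and has exactly `N(w) = #(𝓞 K ⧸ w)` elements**: the degree of the Borel push-forward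
operator `T^B_{t₂⁻¹}`. [cite: Harder1987, §2] -/
theorem card_doubleCosetQuot_borelHeckeElement₂_inv :
    (finite_doubleCosetQuot_borelHeckeElement₂_inv hw hU).toFinset.card = Ideal.absNorm w.asIdeal := by
  obtain ⟨ι, _, b, hbint, hb, hbinj, hcard⟩ := exists_residueSystem_card K w
  have hϖ := valued_coe_uniformizerAt (K := K) w
  rw [← Set.ncard_eq_toFinset_card _ (finite_doubleCosetQuot_borelHeckeElement₂_inv hw hU),
    ← Set.ncard_image_of_injective _ (TwistedQuotient.toQuot_injective U (borelAwayFrom S)),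
    image_toQuot_doubleCosetQuot_borelHeckeElement₂_inv_eq_range hw hU b hbint hb,
    Set.ncard_range_of_injective, hcard]
  exact hU.localCoset_injective.comp
    (upperRight_mul_heckeLocalDiag'_inv_coset_injective _ b (uniformizerAt w).ne_zero hϖ hbinj)

end Contract

/-! ### Push–pull and the factorisation of `T^B_{t₁}` on the Borel model -/

section Cohomology

variable {k : Type} [CommRing k] {Γ : Type} [Group Γ] (ι : Γ →* FiniteAdelicGL 2 K)
  (hι : ∀ γ, ι γ ∈ borelAwayFrom (n := 2) S)
  {V : Type} [AddCommGroup V] [Module k V] (ρ : Representation k Γ V)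

include hw hU

/-- **Push–pull: `T^B_{t₂⁻¹} (T^B_{t₂} y) = N(w) • y`** on the twisted cohomology of the Borel model.
[cite: Harder1987, §2] -/
theorem heckeEnd_borelHeckeElement₂_inv_heckeEnd (q : ℕ)
    (y : TwistedQuotient.cohomology (ι.codRestrict _ hι) (U.subgroupOf (borelAwayFrom S)) ρ q) :
    TwistedQuotient.heckeEnd (ι.codRestrict _ hι) (U.subgroupOf (borelAwayFrom S)) ρ
        ((borelHeckeElement₂ S w)⁻¹) q
      (TwistedQuotient.heckeEnd (ι.codRestrict _ hι) (U.subgroupOf (borelAwayFrom S)) ρ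
        (borelHeckeElement₂ S w) q y) = Ideal.absNorm w.asIdeal • y := by
  rw [TwistedQuotient.heckeEnd_inv_apply_heckeEnd_of_conj _ _ ρ (borelHeckeElement₂_conj_mem hw hU)
    (finite_doubleCosetQuot_borelHeckeElement₂_inv hw hU), card_doubleCosetQuot_borelHeckeElement₂_inv hw hU]

/-- The central element `z_w = t_{w,2} = ι_w(ϖ · 1)` of `H_S`. [folklore] -/
def borelCentralElement (S : Set (HeightOneSpectrum (𝓞 K))) (w : HeightOneSpectrum (𝓞 K)) :
    borelAwayFrom (n := 2) S :=
  ⟨heckeElement 2 K w 2, by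
    rw [heckeElement_eq_ofLocal]
    exact ofLocal_mem_borelAwayFrom fun _ i j hij => by
      rw [coe_glDiagonal]
      exact Matrix.diagonal_apply_ne _ (show i ≠ j from ne_of_gt hij)⟩

omit hw hU in
/-- `z_w` is `t_{w,2}`. [folklore] -/
@[simp]
theorem coe_borelCentralElement :
    ((borelCentralElement S w : borelAwayFrom (n := 2) S) : FiniteAdelicGL 2 K) = heckeElement 2 K w 2 := rfl

omit hw hU in
/-- `z_w` is central in `H_S`. [folklore] -/
theorem borelCentralElement_mem_center :
    borelCentralElement S w ∈ Subgroup.center (borelAwayFrom (n := 2) S) :=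
  Subgroup.mem_center_iff.2 fun x => Subtype.ext (heckeElement_self_mul_comm w (x : FiniteAdelicGL 2 K)).symm

omit hw hU in
/-- **`t^B_1 = z_w (t^B_2)⁻¹`** (`diag(ϖ,1) = (ϖ·1) diag(1,ϖ)⁻¹`). [folklore] -/
theorem borelHeckeElement₁_eq :
    borelHeckeElement₁ S w = borelCentralElement S w * (borelHeckeElement₂ S w)⁻¹ := by
  refine Subtype.ext ?_
  rw [Subgroup.coe_mul, Subgroup.coe_inv, coe_borelCentralElement, coe_borelHeckeElement₂,
    coe_borelHeckeElement₁, heckeElement_one_eq_ofLocal_localT₁, heckeElement_eq_ofLocal, ← map_inv,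
    ← map_mul]
  congr 1
  ext i j
  rw [Units.val_mul, coe_glDiagonal, coe_heckeLocalDiag, coe_heckeLocalDiag'_inv]
  fin_cases i <;> fin_cases j <;> simp [Matrix.mul_apply, Fin.sum_univ_two, (uniformizerAt w).ne_zero]

/-- **`T^B_{t₁} y = T^B_{t₂⁻¹} (T_{z_w} y)`** on the Borel model. [cite: Harder1987, §2] -/
theorem heckeEnd_borelHeckeElement₁_eq (q : ℕ)
    (y : TwistedQuotient.cohomology (ι.codRestrict _ hι) (U.subgroupOf (borelAwayFrom S)) ρ q) :
    TwistedQuotient.heckeEnd (ι.codRestrict _ hι) (U.subgroupOf (borelAwayFrom S)) ρ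
        (borelHeckeElement₁ S w) q y =
      TwistedQuotient.heckeEnd (ι.codRestrict _ hι) (U.subgroupOf (borelAwayFrom S)) ρ
          ((borelHeckeElement₂ S w)⁻¹) q
        (TwistedQuotient.heckeEnd (ι.codRestrict _ hι) (U.subgroupOf (borelAwayFrom S)) ρ
          (borelCentralElement S w) q y) := by
  rw [borelHeckeElement₁_eq]
  exact TwistedQuotient.heckeEnd_central_mul_apply _ _ ρ borelCentralElement_mem_center
    (finite_doubleCosetQuot_borelHeckeElement₂_inv hw hU) q y

/-- `T^B_{t₂}` commutes with `T_{z_w}`. [folklore] -/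
theorem heckeEnd_borelHeckeElement₂_comm_central (q : ℕ)
    (y : TwistedQuotient.cohomology (ι.codRestrict _ hι) (U.subgroupOf (borelAwayFrom S)) ρ q) :
    TwistedQuotient.heckeEnd (ι.codRestrict _ hι) (U.subgroupOf (borelAwayFrom S)) ρ
        (borelHeckeElement₂ S w) q
      (TwistedQuotient.heckeEnd (ι.codRestrict _ hι) (U.subgroupOf (borelAwayFrom S)) ρ
        (borelCentralElement S w) q y) =
      TwistedQuotient.heckeEnd (ι.codRestrict _ hι) (U.subgroupOf (borelAwayFrom S)) ρ
          (borelCentralElement S w) q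
        (TwistedQuotient.heckeEnd (ι.codRestrict _ hι) (U.subgroupOf (borelAwayFrom S)) ρ
          (borelHeckeElement₂ S w) q y) :=
  TwistedQuotient.heckeEnd_comm_central _ _ ρ borelCentralElement_mem_center
    (finite_doubleCosetQuot_borelHeckeElement hw hU false) q y

omit hw hU in
/-- **`res (T_{w,2} x) = T_{z_w} (res x)`**: the central operator passes to the Borel model
unchanged. [cite: Harder1987, §2] -/
theorem subgroupRestrictMap_heckeEnd_heckeElement_two (q : ℕ)
    (x : TwistedQuotient.cohomology ι U ρ q) :
    (TwistedQuotient.subgroupRestrictMap ι U ρ (borelAwayFrom S) hι q).hom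
        (TwistedQuotient.heckeEnd ι U ρ (heckeElement 2 K w 2) q x) =
      TwistedQuotient.heckeEnd (ι.codRestrict _ hι) (U.subgroupOf (borelAwayFrom S)) ρ
          (borelCentralElement S w) q
          ((TwistedQuotient.subgroupRestrictMap ι U ρ (borelAwayFrom S) hι q).hom x) := by
  have hz : heckeElement 2 K w 2 ∈ Subgroup.center (FiniteAdelicGL 2 K) :=
    Subgroup.mem_center_iff.2 fun g => (heckeElement_self_mul_comm w g).symm
  refine TwistedQuotient.subgroupRestrictMap_heckeEnd_apply_single ι U ρ (borelAwayFrom S) hι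
    (borelCentralElement S w) ?_ ?_ q x
  · rw [ArithmeticQuotient.doubleCosetQuot_eq_singleton_of_mem_center _ borelCentralElement_mem_center]
    exact Set.finite_singleton _
  · rw [ArithmeticQuotient.doubleCosetQuot_eq_singleton_of_mem_center _ hz,
      ArithmeticQuotient.doubleCosetQuot_eq_singleton_of_mem_center _ borelCentralElement_mem_center,
      Set.image_singleton, TwistedQuotient.toQuot_mk, coe_borelCentralElement]

end Cohomology

end BigHeckeGLn

end Literature.NumberTheory.Automorphic
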